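import Summits.QuantumFields.GaugeBoot.GroupAveraging
import Summits.QuantumFields.GaugeBoot.SchwingerDysonStates
import HarnessLib

/-!
# Schwinger–Dyson rows with INVARIANT test functions along shifts commuting with a symmetry group (gauge-boot, L1 supplement)

HONEST FRAMING (cell `pub-gaugeboot`, page 1 of every file): the venture produces certified bounds
on lattice expectations at stated coupling, gauge group, dimension and torus size; NOT a mass gap,
NOT a continuum limit, NOT a string tension; NOT Yang–Mills-summit-bearing (barriers
`FixedCouplingUltralocality`, `PerturbativeInvisibility`). This module is a structural statement
about configuration spaces `ι → G`; it certifies no number.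

## Content — the positive twin of `AdInvariantSchwingerDysonRows.lean`

`AdInvariantSchwingerDysonRows.lean` (lean3 gen 72): a Schwinger–Dyson row along a TRACELESS
direction with a conjugation-invariant test function is `0 = β · 0` — no information. Here: rows
along one-link shifts that COMMUTE with the action `act : H → (ι → G) → (ι → G)` of a compact
symmetry group `H` (for the lattice gauge group: shifts along CENTRAL one-parameter subgroups —
every direction of `U(1)`, the `U(1)` factor of `U(N)`) lose nothing when the test functions are
restricted to `H`-INVARIANT observables:

* `IsSchwingerDysonStateOn P k S β μ` — the rows of `IsSchwingerDysonState` (`SchwingerDysonStates`)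
  for test functions in a class `P` only (`P = ⊤`: `isSchwingerDysonStateOn_univ_iff`; in the
  sequel `P` = gauge-invariant observables);
* ★ `IsSchwingerDysonStateOn.integral_comp_update_mul_of_invariant` — rows for the INVARIANT test
  functions already give the finite HAAR-SHIFT IDENTITY
  `∫ F(U[i ↦ k_a(t) U_i]) dμ = ∫ F(U) e^{-β (S_i(U[i ↦ k_a(t)⁻¹ U_i]) - S_i U)} dμ` for every invariant
  continuous `F` (the averaging trick of `FlowSchwingerDyson.lean` stays inside the invariant class
  when the shift commutes with the action and `S_i` is invariant);
* ★ `haarShift_of_forall_invariant` — for an `act`-INVARIANT state the Haar-shift identity for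
  invariant `F` implies it for EVERY continuous `F` (orbit averaging `GroupAveraging.orbitAverage`
  commutes with the shift; Fubini);
* ★★ `eq_pi_tilted_of_sdOn_invariant` / `eq_pi_tilted_iff_sdOn_invariant` — FINITE VOLUME, invariant
  probability state: the rows for invariant test functions along a commuting family exhausting `G`
  hold iff `μ = (Haar^{⊗ι}).tilted (-β S)`;
* ★★ `IsSchwingerDysonStateOn.avgMeasure` — for ANY finite measure the invariant rows pass to the
  `H`-averaged state `GroupAveraging.avgMeasure` (the flow derivative of an invariant test function
  is invariant, by uniqueness of derivatives), hence
* ★★★ `integral_eq_pi_tilted_of_sdOn_invariant` — FINITE VOLUME, ANY probability state: the rows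
  for invariant test functions determine EVERY INVARIANT EXPECTATION (it is the Gibbs one).

The sequel `CentralLoopEquations.lean` instantiates `H` = the lattice gauge group: for `U(1)` the
gauge-invariant loop equations plus realisability determine every gauge-invariant expectation in
finite volume, at every `β`.

References: M. Creutz, *Quarks, gluons and lattices* (1983) Ch. 11; Z. Li, S. Zhou,
arXiv:2404.17071 §1–2 (the question whether loop equations and positivity determine the abelian
theories, studied numerically); V. Kazakov, Z. Zheng, arXiv:2203.11360 §2. Folklore.
-/

noncomputable section

open MeasureTheory
open Literature.MathematicalPhysics.QuantumFieldTheory (haarProbability)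

namespace Summit.QuantumFields.GaugeBoot

variable {ι : Type*} [DecidableEq ι] {G : Type*} [Group G] [TopologicalSpace G] [MeasurableSpace G]
  {K : Type*} {H : Type*}

/-- **Schwinger–Dyson rows for a class `P` of test functions.** As `IsSchwingerDysonState k S β μ`
(`SchwingerDysonStates.lean`) — for every link `i` and every one-parameter subgroup `k a` of the
family the local action `S i` has a continuous derivative `S'` along `U ↦ U[i ↦ k a (t) · U i]` and
`∫ f' dμ = β ∫ f S' dμ` — but only for the test functions `f` in the class `P` (continuous, with a
continuous derivative `f'` along the shift). [shape] A parametric definition of a proposition —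
NOT a fact. [folklore] -/
def IsSchwingerDysonStateOn (P : ((ι → G) → ℝ) → Prop) (k : K → ℝ → G) (S : ι → (ι → G) → ℝ)
    (β : ℝ) (μ : Measure (ι → G)) : Prop :=
  ∀ (i : ι) (a : K), ∃ S' : (ι → G) → ℝ, Continuous S' ∧
    (∀ U, HasDerivAt (fun t => S i (Function.update U i (k a t * U i))) (S' U) 0) ∧
    ∀ f f' : (ι → G) → ℝ, P f → Continuous f → Continuous f' →
      (∀ U, HasDerivAt (fun t => f (Function.update U i (k a t * U i))) (f' U) 0) →
      ∫ U, f' U ∂μ = β * ∫ U, f U * S' U ∂μ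

section Basic

variable {k : K → ℝ → G} {S : ι → (ι → G) → ℝ} {β : ℝ} {μ : Measure (ι → G)}

/-- The rows for ALL test functions are the Schwinger–Dyson state property. [folklore] -/
theorem isSchwingerDysonStateOn_univ_iff :
    IsSchwingerDysonStateOn (fun _ => True) k S β μ ↔ IsSchwingerDysonState k S β μ := by
  constructor
  · intro h i a
    obtain ⟨S', h1, h2, h3⟩ := h i a
    exact ⟨S', h1, h2, fun f f' => h3 f f' trivial⟩
  · intro h i a
    obtain ⟨S', h1, h2, h3⟩ := h i a
    exact ⟨S', h1, h2, fun f f' _ => h3 f f'⟩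

/-- A Schwinger–Dyson state satisfies the rows of every class. [folklore] -/
theorem IsSchwingerDysonState.on (h : IsSchwingerDysonState k S β μ) (P : ((ι → G) → ℝ) → Prop) :
    IsSchwingerDysonStateOn P k S β μ := by
  intro i a
  obtain ⟨S', h1, h2, h3⟩ := h i a
  exact ⟨S', h1, h2, fun f f' _ => h3 f f'⟩

/-- Monotonicity in the class of test functions. [folklore] -/
theorem IsSchwingerDysonStateOn.mono {P Q : ((ι → G) → ℝ) → Prop} (hPQ : ∀ f, Q f → P f)
    (h : IsSchwingerDysonStateOn P k S β μ) : IsSchwingerDysonStateOn Q k S β μ := by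
  intro i a
  obtain ⟨S', h1, h2, h3⟩ := h i a
  exact ⟨S', h1, h2, fun f f' hf => h3 f f' (hPQ f hf)⟩

end Basic

/-! ## Rows for invariant test functions give the Haar-shift identity for invariant observables -/

section Invariant

variable [IsTopologicalGroup G] [CompactSpace G] [BorelSpace G] [SecondCountableTopology G]
  [Countable ι] {k : K → ℝ → G} {S : ι → (ι → G) → ℝ} {β : ℝ} {act : H → (ι → G) → (ι → G)}

/-- ★ **Invariant rows ⇒ Haar-shift identity for invariant observables.** Let the class `P`
contain every `act`-invariant observable, let the one-link shifts along `k a` at the link `i`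
commute with the action and let `S i` be `act`-invariant. If the finite measure `μ` satisfies the
Schwinger–Dyson rows for the test functions in `P`, then for every `act`-INVARIANT continuous `F`:
`∫ F(U[i ↦ k_a(t) U_i]) dμ = ∫ F(U) e^{-β (S_i(U[i ↦ k_a(t)⁻¹ U_i]) - S_i U)} dμ`. Proof: the test
function of the averaging trick (`FlowSchwingerDyson`), built from `F`, `S i` and the flow, is
invariant. [folklore] -/
theorem IsSchwingerDysonStateOn.integral_comp_update_mul_of_invariant
    (hkc : ∀ a, Continuous (k a)) (hk : ∀ a s t, k a (s + t) = k a s * k a t)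
    (hS : ∀ i, Continuous (S i)) {P : ((ι → G) → ℝ) → Prop} {μ : Measure (ι → G)}
    [IsFiniteMeasure μ] (hμ : IsSchwingerDysonStateOn P k S β μ)
    (hP : ∀ f : (ι → G) → ℝ, (∀ h U, f (act h U) = f U) → P f) (i : ι) (a : K)
    (hcomm : ∀ (h : H) (t : ℝ) (U : ι → G), act h (Function.update U i (k a t * U i)) =
      Function.update (act h U) i (k a t * act h U i))
    (hSinv : ∀ (h : H) (U : ι → G), S i (act h U) = S i U) (t : ℝ) (F : (ι → G) → ℝ)
    (hF : Continuous F) (hFi : ∀ h U, F (act h U) = F U) :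
    ∫ U, F (Function.update U i (k a t * U i)) ∂μ =
      ∫ U, F U * Real.exp (-(β * (S i (Function.update U i ((k a t)⁻¹ * U i)) - S i U))) ∂μ := by
  obtain ⟨S', hS'c, hS', hsd⟩ := hμ i a
  have h := (isContinuousFlow_update_mul (hkc a) (hk a) i).integral_comp_flow_eq_integral_mul_exp_of_sd
    μ (hS i) hS'c hS' β (P := P) (fun f f' hf hfc hf'c hd => hsd f f' hf hfc hf'c hd) hF t
    (hP _ fun h x => by simp only [← hcomm, hFi, hSinv])
  simpa only [update_oneParam_neg (hk a)] using h

/-- ★ **Invariant rows along a commuting family exhausting `G` ⇒ all one-link Haar-shift identities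
for invariant observables**: `∫ F(U[i ↦ g U_i]) dμ = ∫ F(U) e^{-β (S_i(U[i ↦ g⁻¹ U_i]) - S_i U)} dμ` for
every link `i`, every `g ∈ G` and every invariant continuous `F`. [folklore] -/
theorem IsSchwingerDysonStateOn.haarShift_of_invariant (hkc : ∀ a, Continuous (k a))
    (hk : ∀ a s t, k a (s + t) = k a s * k a t) (hG : ∀ g : G, ∃ a t, k a t = g)
    (hS : ∀ i, Continuous (S i)) {P : ((ι → G) → ℝ) → Prop} {μ : Measure (ι → G)}
    [IsFiniteMeasure μ] (hμ : IsSchwingerDysonStateOn P k S β μ)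
    (hP : ∀ f : (ι → G) → ℝ, (∀ h U, f (act h U) = f U) → P f)
    (hcomm : ∀ (h : H) (i : ι) (a : K) (t : ℝ) (U : ι → G),
      act h (Function.update U i (k a t * U i)) = Function.update (act h U) i (k a t * act h U i))
    (hSinv : ∀ (h : H) (i : ι) (U : ι → G), S i (act h U) = S i U) (i : ι) (g : G)
    (F : (ι → G) → ℝ) (hF : Continuous F) (hFi : ∀ h U, F (act h U) = F U) :
    ∫ U, F (Function.update U i (g * U i)) ∂μ =
      ∫ U, F U * Real.exp (-(β * (S i (Function.update U i (g⁻¹ * U i)) - S i U))) ∂μ := by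
  obtain ⟨a, t, rfl⟩ := hG g
  exact hμ.integral_comp_update_mul_of_invariant hkc hk hS hP i a (fun h t U => hcomm h i a t U)
    (hSinv · i) t F hF hFi

/-! ## For an invariant state, invariant observables are as good as all observables -/

variable [TopologicalSpace H] [Group H] [IsTopologicalGroup H] [CompactSpace H] [MeasurableSpace H]
  [BorelSpace H] [SecondCountableTopology H]

omit [IsTopologicalGroup G] [MeasurableSpace G] [CompactSpace G] [BorelSpace G]
  [SecondCountableTopology G] [Countable ι] in
/-- Continuity of a one-link left shift. [folklore] -/
theorem continuous_update_left_mul (i : ι) (g : G) [ContinuousMul G] :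
    Continuous fun U : ι → G => Function.update U i (g * U i) :=
  continuous_id.update i (continuous_const.mul (continuous_apply i))

/-- ★ **Haar-shift identity: invariant observables ⇒ all observables, for an invariant state.**
`H` compact acting jointly continuously by `act` (`act (h h') = act h ∘ act h'`), `μ` finite and
`act`-invariant, the one-link shifts by `g` and `g⁻¹` at `i` commuting with the action, `S i`
invariant and continuous. If `∫ F(U[i ↦ g U_i]) dμ = ∫ F(U) e^{-β (S_i(U[i ↦ g⁻¹ U_i]) - S_i U)} dμ`
holds for every invariant continuous `F`, it holds for EVERY continuous `F`: replace `F` by its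
orbit average, which is continuous, invariant, has the same integrals against `μ` and commutes with
the shift. [folklore] -/
theorem haarShift_of_forall_invariant (hmul : ∀ h h' U, act (h * h') U = act h (act h' U))
    (hact : Continuous fun p : H × (ι → G) => act p.1 p.2) {μ : Measure (ι → G)}
    [IsFiniteMeasure μ] (hμinv : ∀ h, μ.map (act h) = μ) (i : ι) (g : G)
    (hcomm : ∀ (h : H) (U : ι → G),
      act h (Function.update U i (g * U i)) = Function.update (act h U) i (g * act h U i))
    (hcomm' : ∀ (h : H) (U : ι → G),
      act h (Function.update U i (g⁻¹ * U i)) = Function.update (act h U) i (g⁻¹ * act h U i))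
    (hSinv : ∀ (h : H) (U : ι → G), S i (act h U) = S i U) (hS : Continuous (S i))
    (hinv : ∀ F : (ι → G) → ℝ, Continuous F → (∀ h U, F (act h U) = F U) →
      ∫ U, F (Function.update U i (g * U i)) ∂μ =
        ∫ U, F U * Real.exp (-(β * (S i (Function.update U i (g⁻¹ * U i)) - S i U))) ∂μ)
    (F : (ι → G) → ℝ) (hF : Continuous F) :
    ∫ U, F (Function.update U i (g * U i)) ∂μ =
      ∫ U, F U * Real.exp (-(β * (S i (Function.update U i (g⁻¹ * U i)) - S i U))) ∂μ := by
  set w : (ι → G) → ℝ := fun U =>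
    Real.exp (-(β * (S i (Function.update U i (g⁻¹ * U i)) - S i U))) with hw
  have hwc : Continuous w :=
    Real.continuous_exp.comp (continuous_const.mul ((hS.comp (continuous_update_left_mul i g⁻¹)).sub hS)).neg
  have hwi : ∀ h U, w (act h U) = w U := fun h U => by
    simp only [hw, ← hcomm', hSinv]
  have hFa : Continuous (orbitAverage act F) := continuous_orbitAverage hact hF
  calc ∫ U, F (Function.update U i (g * U i)) ∂μ
      = ∫ U, orbitAverage act (fun U => F (Function.update U i (g * U i))) U ∂μ :=
        (integral_orbitAverage_eq_of_map_eq hact (hF.comp (continuous_update_left_mul i g)) μ hμinv).symm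
    _ = ∫ U, orbitAverage act F (Function.update U i (g * U i)) ∂μ := by
        rw [orbitAverage_comp_comm F fun h U => hcomm h U]
    _ = ∫ U, orbitAverage act F U * w U ∂μ := hinv _ hFa (orbitAverage_act hmul F)
    _ = ∫ U, orbitAverage act (fun U => F U * w U) U ∂μ := by
        rw [orbitAverage_mul_of_invariant F hwi]
    _ = ∫ U, F U * w U ∂μ := integral_orbitAverage_eq_of_map_eq hact (hF.mul hwc) μ hμinv

/-! ## Finite volume -/

variable [T2Space G] [Nonempty G]

/-- ★★ **Finite volume, invariant state: the rows for invariant test functions determine the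
state.** `ι` finite, `G` compact metrisable, a family of continuous one-parameter subgroups
exhausting `G` whose one-link shifts commute with the action of the compact group `H`, `S`
continuous and invariant, `P ⊇` the invariant observables: an `act`-invariant probability measure
satisfying the Schwinger–Dyson rows for the test functions in `P` IS `(Haar^{⊗ι}).tilted (-β S)`.
[folklore] -/
theorem eq_pi_tilted_of_sdOn_invariant [Fintype ι] (hkc : ∀ a, Continuous (k a))
    (hk : ∀ a s t, k a (s + t) = k a s * k a t) (hG : ∀ g : G, ∃ a t, k a t = g)
    {S : (ι → G) → ℝ} (hS : Continuous S) {P : ((ι → G) → ℝ) → Prop}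
    (hP : ∀ f : (ι → G) → ℝ, (∀ h U, f (act h U) = f U) → P f)
    (hmul : ∀ h h' U, act (h * h') U = act h (act h' U))
    (hact : Continuous fun p : H × (ι → G) => act p.1 p.2)
    (hcomm : ∀ (h : H) (i : ι) (a : K) (t : ℝ) (U : ι → G),
      act h (Function.update U i (k a t * U i)) = Function.update (act h U) i (k a t * act h U i))
    (hSinv : ∀ (h : H) (U : ι → G), S (act h U) = S U) {μ : Measure (ι → G)}
    [IsProbabilityMeasure μ] (hμinv : ∀ h, μ.map (act h) = μ)
    (hμ : IsSchwingerDysonStateOn P k (fun _ => S) β μ) :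
    μ = (Measure.pi fun _ : ι => haarProbability G).tilted fun U => -β * S U := by
  refine eq_pi_tilted_of_haarShift (ψ := fun U => -β * S U) (continuous_const.mul hS)
    fun i g f hf => ?_
  obtain ⟨a, t, rfl⟩ := hG g
  have hcomm' : ∀ (h : H) (U : ι → G), act h (Function.update U i ((k a t)⁻¹ * U i)) =
      Function.update (act h U) i ((k a t)⁻¹ * act h U i) := fun h U => by
    simpa only [update_oneParam_neg (hk a)] using hcomm h i a (-t) U
  rw [haarShift_of_forall_invariant (S := fun _ => S) (β := β) hmul hact hμinv i (k a t)
    (fun h U => hcomm h i a t U) hcomm' hSinv hS (fun F hF hFi =>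
      hμ.integral_comp_update_mul_of_invariant hkc hk (fun _ => hS) hP i a
        (fun h t U => hcomm h i a t U) hSinv t F hF hFi) f hf]
  refine integral_congr_ae (ae_of_all _ fun U => ?_)
  simp only [show ∀ a b : ℝ, -(β * (a - b)) = -β * a - -β * b from fun a b => by ring]

/-- ★★ **Finite volume, invariant state: rows for invariant test functions ⇔ Gibbs.** With the
data of `eq_pi_tilted_of_sdOn_invariant` and `S` differentiable along the family with continuous
derivative: an `act`-invariant probability measure satisfies the Schwinger–Dyson rows for the test
functions in `P ⊇` invariant observables iff it is `(Haar^{⊗ι}).tilted (-β S)`. [folklore] -/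
theorem eq_pi_tilted_iff_sdOn_invariant [Fintype ι] (hkc : ∀ a, Continuous (k a))
    (hk : ∀ a s t, k a (s + t) = k a s * k a t) (hG : ∀ g : G, ∃ a t, k a t = g)
    {S : (ι → G) → ℝ} (hS : Continuous S)
    (hSd : ∀ (i : ι) (a : K), ∃ S' : (ι → G) → ℝ, Continuous S' ∧
      ∀ U, HasDerivAt (fun t => S (Function.update U i (k a t * U i))) (S' U) 0)
    {P : ((ι → G) → ℝ) → Prop} (hP : ∀ f : (ι → G) → ℝ, (∀ h U, f (act h U) = f U) → P f)
    (hmul : ∀ h h' U, act (h * h') U = act h (act h' U))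
    (hact : Continuous fun p : H × (ι → G) => act p.1 p.2)
    (hcomm : ∀ (h : H) (i : ι) (a : K) (t : ℝ) (U : ι → G),
      act h (Function.update U i (k a t * U i)) = Function.update (act h U) i (k a t * act h U i))
    (hSinv : ∀ (h : H) (U : ι → G), S (act h U) = S U) (β : ℝ) (μ : Measure (ι → G))
    [IsProbabilityMeasure μ] (hμinv : ∀ h, μ.map (act h) = μ) :
    μ = (Measure.pi fun _ : ι => haarProbability G).tilted (fun U => -β * S U) ↔
      IsSchwingerDysonStateOn P k (fun _ => S) β μ := by
  refine ⟨fun hμ => ?_, eq_pi_tilted_of_sdOn_invariant hkc hk hG hS hP hmul hact hcomm hSinv hμinv⟩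
  exact ((eq_pi_tilted_iff_sd hkc hk hG hS hSd β μ).1 hμ).on P

/-! ## Any state: the invariant rows pass to the averaged state -/

omit [IsTopologicalGroup G] [T2Space G] [Nonempty G] in
/-- ★★ **The invariant rows pass to the `H`-averaged state.** If a finite measure `μ` satisfies the
Schwinger–Dyson rows for the `act`-invariant test functions (shifts commuting with the action,
local actions invariant), so does `avgMeasure act μ`: the flow derivative of an invariant test
function and of `S i` are invariant (uniqueness of derivatives), so both sides of each row are
integrals of invariant continuous observables, on which `avgMeasure act μ` and `μ` agree.
[folklore] -/
theorem IsSchwingerDysonStateOn.avgMeasure {μ : Measure (ι → G)} [IsFiniteMeasure μ]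
    (hμ : IsSchwingerDysonStateOn (fun f => ∀ h U, f (act h U) = f U) k S β μ)
    (hact : Continuous fun p : H × (ι → G) => act p.1 p.2)
    (hcomm : ∀ (h : H) (i : ι) (a : K) (t : ℝ) (U : ι → G),
      act h (Function.update U i (k a t * U i)) = Function.update (act h U) i (k a t * act h U i))
    (hSinv : ∀ (h : H) (i : ι) (U : ι → G), S i (act h U) = S i U) :
    IsSchwingerDysonStateOn (fun f => ∀ h U, f (act h U) = f U) k S β (avgMeasure act μ) := by
  intro i a
  obtain ⟨S', hS'c, hS', hsd⟩ := hμ i a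
  refine ⟨S', hS'c, hS', fun f f' hfi hf hf' hd => ?_⟩
  have hf'i : ∀ h U, f' (act h U) = f' U := fun h U => by
    have h1 := hd (act h U)
    simp only [← hcomm, hfi] at h1
    exact h1.unique (hd U)
  have hS'i : ∀ h U, S' (act h U) = S' U := fun h U => by
    have h1 := hS' (act h U)
    simp only [← hcomm, hSinv] at h1
    exact h1.unique (hS' U)
  haveI := isFiniteMeasure_avgMeasure (act := act) μ
  rw [integral_avgMeasure_of_invariant hact hf' hf'i μ,
    integral_avgMeasure_of_invariant hact (F := fun U => f U * S' U) (hf.mul hS'c)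
      (fun h U => by simp only [hfi, hS'i]) μ]
  exact hsd f f' hfi hf hf' hd

/-- ★★★ **Finite volume, ANY state: the rows for invariant test functions determine every
invariant expectation.** `ι` finite, `G` compact metrisable, a family of continuous one-parameter
subgroups exhausting `G` whose one-link shifts commute with the jointly continuous action of the
compact group `H`, `S` continuous and invariant. If a probability measure `μ` satisfies the
Schwinger–Dyson rows `∫ f' dμ = β ∫ f S' dμ` for the INVARIANT test functions, then
`∫ F dμ = ∫ F d(Haar^{⊗ι}).tilted (-β S)` for every invariant continuous `F` — the invariant rows
plus realisability by a probability measure leave no freedom in the invariant sector (the averaged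
state is invariant and satisfies the same rows, hence is the Gibbs measure, and agrees with `μ` on
invariant observables). [folklore] -/
theorem integral_eq_pi_tilted_of_sdOn_invariant [Fintype ι] (hkc : ∀ a, Continuous (k a))
    (hk : ∀ a s t, k a (s + t) = k a s * k a t) (hG : ∀ g : G, ∃ a t, k a t = g)
    {S : (ι → G) → ℝ} (hS : Continuous S)
    (hmul : ∀ h h' U, act (h * h') U = act h (act h' U))
    (hact : Continuous fun p : H × (ι → G) => act p.1 p.2)
    (hcomm : ∀ (h : H) (i : ι) (a : K) (t : ℝ) (U : ι → G),
      act h (Function.update U i (k a t * U i)) = Function.update (act h U) i (k a t * act h U i))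
    (hSinv : ∀ (h : H) (U : ι → G), S (act h U) = S U) {μ : Measure (ι → G)}
    [IsProbabilityMeasure μ]
    (hμ : IsSchwingerDysonStateOn (fun f => ∀ h U, f (act h U) = f U) k (fun _ => S) β μ)
    (F : (ι → G) → ℝ) (hF : Continuous F) (hFi : ∀ h U, F (act h U) = F U) :
    ∫ U, F U ∂μ = ∫ U, F U ∂(Measure.pi fun _ : ι => haarProbability G).tilted fun U => -β * S U := by
  haveI := isProbabilityMeasure_avgMeasure hact μ
  have h1 := hμ.avgMeasure hact hcomm (fun h _ U => hSinv h U)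
  have h2 := eq_pi_tilted_of_sdOn_invariant hkc hk hG hS (P := fun f => ∀ h U, f (act h U) = f U)
    (fun _ hf => hf) hmul hact hcomm hSinv (map_avgMeasure_act hmul hact μ) h1
  rw [← h2, integral_avgMeasure_of_invariant hact hF hFi μ]

/-- ★★★ **Finite volume, ANY state: the averaged state of a solution of the invariant rows is the
Gibbs measure.** [folklore] -/
theorem avgMeasure_eq_pi_tilted_of_sdOn_invariant [Fintype ι] (hkc : ∀ a, Continuous (k a))
    (hk : ∀ a s t, k a (s + t) = k a s * k a t) (hG : ∀ g : G, ∃ a t, k a t = g)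
    {S : (ι → G) → ℝ} (hS : Continuous S)
    (hmul : ∀ h h' U, act (h * h') U = act h (act h' U))
    (hact : Continuous fun p : H × (ι → G) => act p.1 p.2)
    (hcomm : ∀ (h : H) (i : ι) (a : K) (t : ℝ) (U : ι → G),
      act h (Function.update U i (k a t * U i)) = Function.update (act h U) i (k a t * act h U i))
    (hSinv : ∀ (h : H) (U : ι → G), S (act h U) = S U) {μ : Measure (ι → G)}
    [IsProbabilityMeasure μ]
    (hμ : IsSchwingerDysonStateOn (fun f => ∀ h U, f (act h U) = f U) k (fun _ => S) β μ) :
    avgMeasure act μ = (Measure.pi fun _ : ι => haarProbability G).tilted fun U => -β * S U := by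
  haveI := isProbabilityMeasure_avgMeasure hact μ
  exact eq_pi_tilted_of_sdOn_invariant hkc hk hG hS (P := fun f => ∀ h U, f (act h U) = f U)
    (fun _ hf => hf) hmul hact hcomm hSinv (map_avgMeasure_act hmul hact μ)
    (hμ.avgMeasure hact hcomm fun h _ U => hSinv h U)

end Invariant

end Summit.QuantumFields.GaugeBoot

end
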